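/-
Copyright (c) 2026 the pub-hodgecm-mathlib formalisation cell (harness21).  Prover seat hodgecm-mathlib-K2Liu-p11 (g2), Track B «K2-LIT»,
#184♮ = hLiu418 = `stmt-HodgeConjecture-24832`; organ (σ) A7-val, V6-inst TODO-1 (LEAD F0P6-plan (g14) BATCH #33 (2), my socket census 14:41Z): the `P′ ∕ hP′` sockets of
★ `K2LiuA7ValueInstanceFaceV2.faceA4R_two_of_record_v2`.  DEFINITION lane (one `def`) + interface lemmas; no `instance`, no notation, no `sorry`.
-/
import Summits.HodgeConjecture.HodgeConjecture.Theorems.K2LiuIsotropicLineStabiliserClosed    -- ★ (this seat) (m2)+(m4): closedness of line stabilisers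
import Literature.NumberTheory.Automorphic.UnitaryGroupPureTensorEulerProduct               -- ★ `localPi`, `localGLPiEquiv`, `locallyCompactSpace_localPi`
import HarnessLib

/-!
# Crux `HLiu418`, (σ) V6-inst TODO-1: THE STABILISER `P′` OF A LINE IN `U(J)(F_v)` — a closed, locally compact subgroup of `UnitaryGroup.localPi E c N J v`

Cell `hodgecm-mathlib`, crux item hLiu418 = `stmt-HodgeConjecture-24832` (helper lane `--supports`, count-neutral).

`U(J)(F_v) = localPi E c N J v` acts on `E_v^N = Fin N → LocalRing E v` through its matrix `((localGLPiEquiv E N v).symm g).val`.  For a vector `x` we define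
**`lineStab E c N J v x`** := `{g | ∃ t, IsUnit t ∧ g·x = t • x}` as a `Subgroup`; when `x` has a UNIT COORDINATE (`x i₀ = 1` — e.g. the rescaled isotropic Witt
vector of ★ `K2LiuDiagonalWittFrameThree.exists_wittFrame_diagonal_three` mapped to `E_v`, giving the parabolic `P′` of the Ikeda functional) the unit condition is
automatic (`mem_lineStab_iff_of_apply_eq_one`), and ★ `K2LiuIsotropicLineStabiliserClosed` gives **`isClosed_lineStab`** and **`locallyCompactSpace_lineStab`** —
the sockets `hP′ : IsClosed (P′ : Set G)` and `[LocallyCompactSpace ↥P′]` of ★ `faceA4R_two_of_record_v2` with `P′ := lineStab … x`.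
References: [KudlaSweet1997, §1]; [BorelJacquet1979, §4.1]; [GanQiuTakeda2014, §2.7].
HONEST LABEL: HC_CM is proved only modulo the 7 printed citations (2 remaining named inputs: hLiu418 = stmt-HodgeConjecture-24832,
h413 = stmt-HodgeConjecture-24833) until rung 0 closes; count-neutral helper, closes no socket by itself (it discharges the `P′∕hP′` binders).
-/

set_option autoImplicit false
set_option linter.dupNamespace false

noncomputable section

open scoped Matrix
open NumberField IsDedekindDomain Matrix Topology
open Literature.NumberTheory.Automorphic Literature.NumberTheory.Automorphic.UnitaryGroup
open Summit.HodgeConjecture.HodgeConjecture.Cruxes.HLiu418.K2LiuIsotropicLineStabiliserClosed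

namespace Summit.HodgeConjecture.HodgeConjecture.Cruxes.HLiu418.K2LiuLocalLineStabiliserDefs

variable (F E : Type) [Field F] [NumberField F] [Field E] [NumberField E] [Algebra F E] (c : E ≃ₐ[F] E) (N : ℕ) (J : Matrix (Fin N) (Fin N) E)
  (v : HeightOneSpectrum (𝓞 F))

/-- **THE STABILISER OF THE LINE THROUGH `x`** in `U(J)(F_v)`: `{g | ∃ t unit, g·x = t • x}` (matrix of `g` over `E_v = ∏_{w∣v} E_w`). [KudlaSweet1997, §1] -/
def lineStab (x : Fin N → LocalRing E v) : Subgroup (UnitaryGroup.localPi E c N J v) where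
  carrier := {g | ∃ t : LocalRing E v, IsUnit t ∧
    ((UnitaryGroup.localGLPiEquiv E N v).symm (g : UnitaryGroup.LocalGLPi E N v)).val *ᵥ x = t • x}
  one_mem' := ⟨1, isUnit_one, by simp⟩
  mul_mem' := by
    rintro g h ⟨t, ht, hg⟩ ⟨t', ht', hh⟩
    refine ⟨t' * t, ht'.mul ht, ?_⟩
    rw [Subgroup.coe_mul, map_mul, Units.val_mul, ← Matrix.mulVec_mulVec, hh, Matrix.mulVec_smul, hg, smul_smul]
  inv_mem' := by
    rintro g ⟨t, ht, hg⟩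
    obtain ⟨tu, rfl⟩ := ht
    refine ⟨((tu⁻¹ : (LocalRing E v)ˣ) : LocalRing E v), tu⁻¹.isUnit, ?_⟩
    have hinv : ((UnitaryGroup.localGLPiEquiv E N v).symm ((g⁻¹ : UnitaryGroup.localPi E c N J v) : UnitaryGroup.LocalGLPi E N v)).val *
        ((UnitaryGroup.localGLPiEquiv E N v).symm (g : UnitaryGroup.LocalGLPi E N v)).val = 1 := by
      rw [Subgroup.coe_inv, map_inv, Units.inv_mul]
    calc ((UnitaryGroup.localGLPiEquiv E N v).symm ((g⁻¹ : UnitaryGroup.localPi E c N J v) : UnitaryGroup.LocalGLPi E N v)).val *ᵥ x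
        = ((UnitaryGroup.localGLPiEquiv E N v).symm ((g⁻¹ : UnitaryGroup.localPi E c N J v) : UnitaryGroup.LocalGLPi E N v)).val *ᵥ
            (((tu⁻¹ : (LocalRing E v)ˣ) : LocalRing E v) • (((tu : (LocalRing E v)ˣ) : LocalRing E v) • x)) := by
          rw [smul_smul, Units.inv_mul, one_smul]
      _ = ((tu⁻¹ : (LocalRing E v)ˣ) : LocalRing E v) • x := by
          rw [Matrix.mulVec_smul, ← hg, Matrix.mulVec_mulVec, hinv, Matrix.one_mulVec]

/-- Membership (definitional). [folklore] -/
theorem mem_lineStab_iff (x : Fin N → LocalRing E v) (g : UnitaryGroup.localPi E c N J v) :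
    g ∈ lineStab F E c N J v x ↔ ∃ t : LocalRing E v, IsUnit t ∧
      ((UnitaryGroup.localGLPiEquiv E N v).symm (g : UnitaryGroup.LocalGLPi E N v)).val *ᵥ x = t • x :=
  Iff.rfl

/-- **WITH A UNIT COORDINATE THE UNIT CONDITION IS AUTOMATIC**: if `x i₀ = 1`, `g ∈ lineStab x ↔ ∃ t, g·x = t • x` (apply `g⁻¹` and read the `i₀`-coordinate). [folklore] -/
theorem mem_lineStab_iff_of_apply_eq_one {x : Fin N → LocalRing E v} {i₀ : Fin N} (hx : x i₀ = 1) (g : UnitaryGroup.localPi E c N J v) :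
    g ∈ lineStab F E c N J v x ↔ ∃ t : LocalRing E v, ((UnitaryGroup.localGLPiEquiv E N v).symm (g : UnitaryGroup.LocalGLPi E N v)).val *ᵥ x = t • x := by
  refine ⟨fun ⟨t, _, h⟩ => ⟨t, h⟩, fun ⟨t, h⟩ => ⟨t, ?_, h⟩⟩
  -- `x = g⁻¹ (t • x) = t • (g⁻¹ x)`, so `1 = x i₀ = t * (g⁻¹ x) i₀`
  have hinv : ((UnitaryGroup.localGLPiEquiv E N v).symm ((g⁻¹ : UnitaryGroup.localPi E c N J v) : UnitaryGroup.LocalGLPi E N v)).val *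
      ((UnitaryGroup.localGLPiEquiv E N v).symm (g : UnitaryGroup.LocalGLPi E N v)).val = 1 := by
    rw [Subgroup.coe_inv, map_inv, Units.inv_mul]
  have hx' : x = t • (((UnitaryGroup.localGLPiEquiv E N v).symm ((g⁻¹ : UnitaryGroup.localPi E c N J v) : UnitaryGroup.LocalGLPi E N v)).val *ᵥ x) := by
    rw [← Matrix.mulVec_smul, ← h, Matrix.mulVec_mulVec, hinv, Matrix.one_mulVec]
  have h1 : t * (((UnitaryGroup.localGLPiEquiv E N v).symm ((g⁻¹ : UnitaryGroup.localPi E c N J v) : UnitaryGroup.LocalGLPi E N v)).val *ᵥ x) i₀ = 1 := by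
    have := congrFun hx' i₀
    rw [Pi.smul_apply, smul_eq_mul, hx] at this
    exact this.symm
  exact isUnit_iff_exists_inv.2 ⟨_, h1⟩

/-- The carrier as the plain stabiliser set of ★ `K2LiuIsotropicLineStabiliserClosed` (unit coordinate). [folklore] -/
theorem coe_lineStab_eq {x : Fin N → LocalRing E v} {i₀ : Fin N} (hx : x i₀ = 1) :
    (lineStab F E c N J v x : Set (UnitaryGroup.localPi E c N J v)) =
      {g | ∃ t : LocalRing E v, (fun g : UnitaryGroup.localPi E c N J v =>
        ((UnitaryGroup.localGLPiEquiv E N v).symm (g : UnitaryGroup.LocalGLPi E N v)).val *ᵥ x) g = t • x} := by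
  ext g
  exact mem_lineStab_iff_of_apply_eq_one F E c N J v hx g

/-- The orbit map `g ↦ g·x` is continuous (the matrix of `g` depends continuously on `g`: ★ `localGLPiEquiv` is a homeomorphism). [BorelJacquet1979, §4.1] -/
theorem continuous_mulVec_apply (x : Fin N → LocalRing E v) :
    Continuous fun g : UnitaryGroup.localPi E c N J v => ((UnitaryGroup.localGLPiEquiv E N v).symm (g : UnitaryGroup.LocalGLPi E N v)).val *ᵥ x := by
  have hG : Continuous fun g : UnitaryGroup.localPi E c N J v => ((UnitaryGroup.localGLPiEquiv E N v).symm (g : UnitaryGroup.LocalGLPi E N v)).val :=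
    Units.continuous_val.comp ((UnitaryGroup.localGLPiEquiv E N v).symm.continuous.comp continuous_subtype_val)
  exact hG.matrix_mulVec continuous_const

/-- **`hP′`: THE LINE STABILISER IS CLOSED** (unit coordinate; ★ `isClosed_subgroup_of_coe_eq`). [KudlaSweet1997, §1] [BorelJacquet1979, §4.1] -/
theorem isClosed_lineStab {x : Fin N → LocalRing E v} {i₀ : Fin N} (hx : x i₀ = 1) :
    IsClosed (lineStab F E c N J v x : Set (UnitaryGroup.localPi E c N J v)) :=
  isClosed_subgroup_of_coe_eq (lineStab F E c N J v x) _ (continuous_mulVec_apply F E c N J v x) hx (coe_lineStab_eq F E c N J v hx)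

/-- **`[LocallyCompactSpace ↥P′]`: THE LINE STABILISER IS LOCALLY COMPACT** (closed in the locally compact `U(J)(F_v)`). [BorelJacquet1979, §4.1] -/
theorem locallyCompactSpace_lineStab {x : Fin N → LocalRing E v} {i₀ : Fin N} (hx : x i₀ = 1) : LocallyCompactSpace ↥(lineStab F E c N J v x) := by
  haveI := UnitaryGroup.locallyCompactSpace_localPi E N c J v
  exact locallyCompactSpace_of_isClosed_subgroup (lineStab F E c N J v x) (isClosed_lineStab F E c N J v hx)

end Summit.HodgeConjecture.HodgeConjecture.Cruxes.HLiu418.K2LiuLocalLineStabiliserDefs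

end
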